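import Summits.Ventures.CertifiedQuantumChemistry.Certificates.H8RingSto3gR0707FastVector
import HarnessLib

/-!
# Ventures/CertifiedQuantumChemistry — Certificates/H8RingSto3gR0707FastRows3.lean: row chunks part 3 of 5 of the kernel
# discharge of `cert_h8ringsto3gr0707_fci_r103_upper` (H₈ ring STO-3G, sector `(4,4)`)

HONEST FRAMING (verbatim): certified bounds for a stated model Hamiltonian in a stated basis; not a
claim about the real molecule beyond that model.

var-2 (gen 16), zero compute. PART 3 of 5 (part 1 = `…FastRows.lean` with the table agreement and the mask checks;
the discharge = `…FastUpper.lean`). Machinery: `Rows/OccupationBitmasks.lean`,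
`Rows/OccupationVectorMasks.lean`, `Rows/SlaterCondonFast.lean`, `Rows/CIFastRows.lean` (var-2 g16); data:
`Certificates/H8RingSto3gR0707FastTables.lean` / `…FastVector.lean`. Contents: the row inequalities `fastRow i ≤ R_i` of the upper-triangle Rayleigh
numerator (`Rows/CIFastRows.lean`) for the chunks `[315,351)`, `[351,390)`, `[390,432)`, `[432,474)`, `[474,521)`, each ONE `decide +kernel`
(≈ 96 s of kernel time on the farm in this file). Decided facts only; no claim node; 0 sorry.
-/

set_option linter.style.longLine false

namespace Summit.Ventures.CertifiedQuantumChemistry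

namespace Certificates

set_option maxHeartbeats 100000000 in
/-- Rows `315 ≤ i < 351`: `fastRow i ≤ R_i` (in fact `=`); ONE `decide +kernel` (cost units 51616). -/
theorem h8f_rows_315_351 : ∀ i < 351, 315 ≤ i → h8fT.fastRow h8fMask h8fCoef 1196 i ≤ h8fR i := by
  decide +kernel

set_option maxHeartbeats 100000000 in
/-- Rows `351 ≤ i < 390`: `fastRow i ≤ R_i` (in fact `=`); ONE `decide +kernel` (cost units 52164). -/
theorem h8f_rows_351_390 : ∀ i < 390, 351 ≤ i → h8fT.fastRow h8fMask h8fCoef 1196 i ≤ h8fR i := by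
  decide +kernel

set_option maxHeartbeats 100000000 in
/-- Rows `390 ≤ i < 432`: `fastRow i ≤ R_i` (in fact `=`); ONE `decide +kernel` (cost units 52322). -/
theorem h8f_rows_390_432 : ∀ i < 432, 390 ≤ i → h8fT.fastRow h8fMask h8fCoef 1196 i ≤ h8fR i := by
  decide +kernel

set_option maxHeartbeats 100000000 in
/-- Rows `432 ≤ i < 474`: `fastRow i ≤ R_i` (in fact `=`); ONE `decide +kernel` (cost units 52144). -/
theorem h8f_rows_432_474 : ∀ i < 474, 432 ≤ i → h8fT.fastRow h8fMask h8fCoef 1196 i ≤ h8fR i := by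
  decide +kernel

set_option maxHeartbeats 100000000 in
/-- Rows `474 ≤ i < 521`: `fastRow i ≤ R_i` (in fact `=`); ONE `decide +kernel` (cost units 52181). -/
theorem h8f_rows_474_521 : ∀ i < 521, 474 ≤ i → h8fT.fastRow h8fMask h8fCoef 1196 i ≤ h8fR i := by
  decide +kernel

end Certificates

end Summit.Ventures.CertifiedQuantumChemistry
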